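/-
Copyright (c) 2026 the pub-hodgecm-mathlib formalisation cell (harness21).  Prover seat hodgecm-mathlib-LH4-p03 (g8); dealer LH4-plan (g6) WORD #66 (P3⁗)
«LAYER B BOTTOM 1∕3», 2026-09-02.  Count-neutral base layer of the dyadic (D-UNR) column (FINDING #6 of the LH4 board).
-/
import Literature.NumberTheory.Automorphic.UnitaryThreeDoubleCosetsHK
import HarnessLib

/-!
# Flicker's double cosets `G = ⊔_{m ≥ 0} H · u_m · K` of the quasi-split `p`-adic `U(3)` WITHOUT `|2| = 1`: the level elements `u_m^{(y,z)}`
# (Flicker 1998, «Elementary proof of the fundamental lemma for a unitary group», Prop. 4 pp. 80–81 — every residue characteristic)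

Topic `NumberTheory/Automorphic`; namespace `Literature.NumberTheory.Automorphic.UnitaryGroup`.  THEOREMS ONLY (no `def`, no instance, no notation,
no named fact, no `sorry`).  Cell `pub/hodgecm-mathlib`, crux H413 = `stmt-HodgeConjecture-24833`; LH4 board (D-UNR) FINDING #6: Flicker's engine (★
`UnitaryThreeDoubleCosetsHK*`, `UnitaryThreeBorelCosetCount*`, …) is written in a PARAMETRISATION that needs a norm `−2` (`u_m`'s third column is
isotropic iff `2 + y·σy = 0`) and the datum ★ `LocalConjDatum` (`|2| = 1`); at an inert-unramified DYADIC place with `ord_v 2` odd no such `y`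
exists.  This file is the first brick of the 2-free re-cut («LAYER B 1∕3»): the twin of ★ `UnitaryThreeDoubleCosetsHK` (file 1 of the engine) over ★
`UnramifiedLocalConjDatum` (every residue characteristic), with Flicker's `u_m` replaced by the two-parameter family

  `u_m^{(y,z)} := u(y, z) · d(ϖ^m, 1, ϖ^{−m}) = !![ϖ^m, y, z·ϖ^{−m}; 0, 1, −σy·ϖ^{−m}; 0, 0, ϖ^{−m}]`,  `z + σz + y·σy = 0`

(the relation is the tree's unipotent relation of ★ `exists_coe_eq_upper_of_mem_unipotentU`).  Flicker's element is the instance `(y, z) = (y, 1)`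
(`⟺ y·σy = −2`, ★ `exists_coe_eq_flickerU`); the TRACE-FRAME instance is `(y, z) = (1, −b)` with `b + σb = 1` — the trace-one integer of ★
`UnramifiedLocalConjDatum.trace`, available at every unramified place in every residue characteristic (§4).

* §1 `exists_coe_eq_flickerU_of_rel` (`u_m^{(y,z)} ∈ U`), `flickerU_of_rel_eq_upper_mul_diag` (the Cartan reading `u(y,z)·d_m`), `flickerU_of_rel_mul_eq_one` ∕
  `mul_flickerU_of_rel_eq_one` ∕ `coe_inv_of_coe_eq_flickerU_of_rel` (the inverse `d_m⁻¹·u(−y, σz)`, INTEGRAL formula, no `½`), `mem_unitaryInt_of_coe_eq_upper`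
  (`u(y,z) ∈ K₀` for `|y|, |z| ≤ 1`), `v_apply_one_of_coe_eq_flickerU_of_rel` (middle-row valuations `≤ q^m`, `= q^m` at `(1,2)`, for `|y| = 1`).
* §2 **`eq_of_centralizer_mul_flickerU_mul_unitaryInt_eq_of_rel`** — the double cosets `H u_m^{(y,z)} K₀` are pairwise distinct (`|y| = 1` a HYPOTHESIS; the
  `h2 : (2 : K) ≠ 0` is the CHARACTERISTIC condition behind the block shape of `Z(diag(1,−1,1))`, ★ `apply_eq_zero_of_mem_centralizer`, automatic for the
  number-field completions `L_w` — not `|2| = 1`).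
* §3 **`exists_mem_centralizer_mul_flickerU_mul_mem_unitaryInt_of_rel`** — `U = ⋃_{m ≥ 0} H · u_m^{(y,z)} · K₀` for `|y| = 1`, `|z| ≤ 1`, with NO `½` and NO `h2`:
  Flicker's split `u(w, z₀) = u(0, z₀ + wσw∕2)·u(w, −wσw∕2)` is replaced by `u(w, z₀) = u(0, z₀ − z₁)·u(w, z₁)`, **`z₁ := (wσw ∕ yσy)·z`**
  (`z₁ + σz₁ = −wσw` by the relation, so `z₀ − z₁` is skew and `u(0, z₀ − z₁) ∈ H`), and then `u(w, z₁) = d(w∕y, 1, ·)·u_m^{(y,z)}·d(ε⁻¹, 1, σε)` exactly as in print.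
* §4 `exists_rel_of_trace`, `exists_coe_eq_flickerU_trace` — the trace-frame instance `(1, −b)` from the datum.
Consumers (LAYER B 2∕3, 3∕3): the `H^K_m` congruences (★ `UnitaryThreeDoubleCosetsHKStabilizer` twin) and the coset counts.  HONEST LABEL: HC_CM is proved only
modulo the printed citations (hLiu418 = `stmt-HodgeConjecture-24832`, h413 = `stmt-HodgeConjecture-24833`) until rung 0 closes; this is structure theory, it
pays no organ and opens no road ((D-UNR) stays PRINT by D74′).

## References
* [Flicker1998UnitaryFL] Y. Z. Flicker, *Elementary proof of the fundamental lemma for a unitary group*, Canad. J. Math. 50 (1998), §2 p. 78 (`J`, `H`), §3 Prop. 4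
  pp. 80–81 (`u_m`, `G = ⊔ H u_m K`, disjointness by the middle row).
* [Rogawski1990] J. D. Rogawski, *Automorphic Representations of Unitary Groups in Three Variables* (1990), §1.9–§1.10 pp. 8–9 (`Φ`, `B = MN`, `u(x,z)`), §4.5 p. 45
  (Iwasawa decomposition).
* [BruhatTits1972] F. Bruhat, J. Tits, *Groupes réductifs sur un corps local I*, Publ. IHÉS 41 (1972), (4.4.3) (`G = BK`).
* [Serre1979] J.-P. Serre, *Local Fields*, GTM 67 (1979), Ch. V §2 Prop. 3 (trace and norm in unramified extensions — the source of `b`).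
-/

set_option autoImplicit false

open scoped MatrixGroups WithZero
open Matrix

namespace Literature.NumberTheory.Automorphic

namespace UnitaryGroup

open Literature.NumberTheory.Automorphic.HermitianLattice (unitaryInt mem_unitaryInt_iff UnramifiedLocalConjDatum)

section Setting

variable {K : Type*} [Field K] [Valued K ℤᵐ⁰] {ϖ : K}
  (σ : K →+* K) {J : Matrix (Fin 3) (Fin 3) K} (hJ : J = (StdForm.antidiagonal 3).over K)

/-- `rev` on `Fin 3`. [folklore] -/ private theorem rev0t : Fin.rev (0 : Fin 3) = 2 := rfl
/-- `rev` on `Fin 3`. [folklore] -/ private theorem rev1t : Fin.rev (1 : Fin 3) = 1 := rfl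
/-- `rev` on `Fin 3`. [folklore] -/ private theorem rev2t : Fin.rev (2 : Fin 3) = 0 := rfl

omit [Valued K ℤᵐ⁰] in
include hJ in
/-- Constructor: a `3 × 3` matrix with non-zero determinant satisfying the nine unitarity relations is (the matrix of) an element
of `U(σ, Φ₃)` (★ `mem_unitaryGroupOfForm_antidiagonal_iff_sum'`). [cite: Rogawski1990, §1.9 p. 8] -/
private theorem exists_coe_eq_of_sum_t (M : Matrix (Fin 3) (Fin 3) K) (hdet : M.det ≠ 0)
    (hsum : ∀ a b : Fin 3, ∑ i, σ (M i a) * M (Fin.rev i) b = if b = Fin.rev a then 1 else 0) :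
    ∃ g : ↥(unitaryGroupOfForm σ J), ((g : GL (Fin 3) K) : Matrix (Fin 3) (Fin 3) K) = M := by
  have hmem : Matrix.GeneralLinearGroup.mkOfDetNeZero M hdet ∈ unitaryGroupOfForm σ J := by
    rw [hJ, mem_unitaryGroupOfForm_antidiagonal_iff_sum']
    simpa [Matrix.GeneralLinearGroup.val_mkOfDetNeZero] using hsum
  exact ⟨⟨_, hmem⟩, Matrix.GeneralLinearGroup.val_mkOfDetNeZero _ _⟩

/-! ## §1 The level elements `u_m^{(y,z)} = u(y,z) · d_m` -/

include hJ in
/-- **`u_m^{(y,z)} ∈ U(σ, Φ₃)`** for ANY pair `(y, z)` with the unipotent relation `z + σz + y·σy = 0`: the matrix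
`!![ϖ^m, y, z·ϖ^{−m}; 0, 1, −σy·ϖ^{−m}; 0, 0, ϖ^{−m}] = u(y, z) · d(ϖ^m, 1, ϖ^{−m})` is unitary for `Φ₃ = antidiag(1,1,1)` (its columns have Gram matrix
`antidiag(1,1,1)`; the third column is isotropic exactly by the relation).  Flicker's `u_m` (★ `exists_coe_eq_flickerU`) is `(y, z) = (y, 1)`, i.e.
`y·σy = −2`; no condition on `|2|` here. [cite: Flicker1998UnitaryFL, Prop. 4 p. 80] [cite: Rogawski1990, §1.10 p. 9] -/
theorem exists_coe_eq_flickerU_of_rel (hd : UnramifiedLocalConjDatum σ ϖ) {y z : K} (hz : z + σ z + y * σ y = 0) (m : ℕ) :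
    ∃ u : ↥(unitaryGroupOfForm σ J), ((u : GL (Fin 3) K) : Matrix (Fin 3) (Fin 3) K) =
      !![ϖ ^ m, y, z * (ϖ ^ m)⁻¹; 0, 1, -σ y * (ϖ ^ m)⁻¹; 0, 0, (ϖ ^ m)⁻¹] := by
  have hϖ0 : ϖ ≠ 0 := hd.ϖ_ne_zero
  have ht0 : ϖ ^ m ≠ 0 := pow_ne_zero _ hϖ0
  have hσt : σ (ϖ ^ m) = ϖ ^ m := by rw [map_pow, hd.σϖ]
  have hσy : σ (σ y) = y := hd.σσ y
  refine exists_coe_eq_of_sum_t σ hJ _ ?_ ?_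
  · rw [Matrix.det_fin_three]; simp [ht0]
  · intro a b
    fin_cases a <;> fin_cases b <;>
      simp [Fin.sum_univ_three, rev1t, rev2t, map_neg, map_mul, map_inv₀, hσt, hσy, ht0]
    · ring
    · field_simp
      linear_combination hz

omit [Valued K ℤᵐ⁰] in
/-- **The Cartan reading `u_m^{(y,z)} = u(y, z) · d(ϖ^m, 1, ϖ^{−m})`** (pure matrix algebra). [cite: Flicker1998UnitaryFL, Prop. 4 p. 80] -/
theorem flickerU_of_rel_eq_upper_mul_diag (ϖ y z : K) (m : ℕ) :
    (!![ϖ ^ m, y, z * (ϖ ^ m)⁻¹; 0, 1, -σ y * (ϖ ^ m)⁻¹; 0, 0, (ϖ ^ m)⁻¹] : Matrix (Fin 3) (Fin 3) K) =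
      !![1, y, z; 0, 1, -σ y; 0, 0, 1] * !![ϖ ^ m, 0, 0; 0, 1, 0; 0, 0, (ϖ ^ m)⁻¹] := by
  ext i j
  fin_cases i <;> fin_cases j <;> simp [Matrix.mul_apply, Fin.sum_univ_three]

omit [Valued K ℤᵐ⁰] in
/-- **`u_m^{(y,z)} · (d_m⁻¹ · u(−y, σz)) = 1`**: the inverse of `u(y, z)` in the Heisenberg group is `u(−y, σz)` (`−z − y·σy = σz` by the relation), so
`(u_m^{(y,z)})⁻¹ = !![ϖ^{−m}, −y·ϖ^{−m}, σz·ϖ^{−m}; 0, 1, σy; 0, 0, ϖ^m]` — an INTEGRAL formula in `y, z, σy, σz` (no `½`).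
[cite: Rogawski1990, §1.10 p. 9] [cite: Flicker1998UnitaryFL, Prop. 4 p. 80] -/
theorem flickerU_of_rel_mul_eq_one {ϖ y z : K} (hϖ : ϖ ≠ 0) (hz : z + σ z + y * σ y = 0) (m : ℕ) :
    (!![ϖ ^ m, y, z * (ϖ ^ m)⁻¹; 0, 1, -σ y * (ϖ ^ m)⁻¹; 0, 0, (ϖ ^ m)⁻¹] : Matrix (Fin 3) (Fin 3) K) *
      !![(ϖ ^ m)⁻¹, -y * (ϖ ^ m)⁻¹, σ z * (ϖ ^ m)⁻¹; 0, 1, σ y; 0, 0, ϖ ^ m] = 1 := by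
  have ht0 : ϖ ^ m ≠ 0 := pow_ne_zero _ hϖ
  ext i j
  fin_cases i <;> fin_cases j <;> simp [Matrix.mul_apply, Fin.sum_univ_three, ht0]
  all_goals first
    | (field_simp; linear_combination hz)
    | (field_simp; ring)

omit [Valued K ℤᵐ⁰] in
/-- **`(d_m⁻¹ · u(−y, σz)) · u_m^{(y,z)} = 1`** (the reverse product). [cite: Rogawski1990, §1.10 p. 9] -/
theorem mul_flickerU_of_rel_eq_one {ϖ y z : K} (hϖ : ϖ ≠ 0) (hz : z + σ z + y * σ y = 0) (m : ℕ) :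
    (!![(ϖ ^ m)⁻¹, -y * (ϖ ^ m)⁻¹, σ z * (ϖ ^ m)⁻¹; 0, 1, σ y; 0, 0, ϖ ^ m] : Matrix (Fin 3) (Fin 3) K) *
      !![ϖ ^ m, y, z * (ϖ ^ m)⁻¹; 0, 1, -σ y * (ϖ ^ m)⁻¹; 0, 0, (ϖ ^ m)⁻¹] = 1 := by
  have ht0 : ϖ ^ m ≠ 0 := pow_ne_zero _ hϖ
  ext i j
  fin_cases i <;> fin_cases j <;> simp [Matrix.mul_apply, Fin.sum_univ_three, ht0]
  all_goals first
    | (field_simp; linear_combination hz)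
    | (field_simp; ring)

/-- **The inverse of `u_m^{(y,z)}` in `U`**, entrywise: `↑(u⁻¹) = !![ϖ^{−m}, −y·ϖ^{−m}, σz·ϖ^{−m}; 0, 1, σy; 0, 0, ϖ^m]`.
[cite: Flicker1998UnitaryFL, Prop. 4 p. 80] [cite: Rogawski1990, §1.10 p. 9] -/
theorem coe_inv_of_coe_eq_flickerU_of_rel (hd : UnramifiedLocalConjDatum σ ϖ) {y z : K} (hz : z + σ z + y * σ y = 0) {m : ℕ}
    {u : ↥(unitaryGroupOfForm σ J)}
    (hu : ((u : GL (Fin 3) K) : Matrix (Fin 3) (Fin 3) K) = !![ϖ ^ m, y, z * (ϖ ^ m)⁻¹; 0, 1, -σ y * (ϖ ^ m)⁻¹; 0, 0, (ϖ ^ m)⁻¹]) :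
    (((u⁻¹ : ↥(unitaryGroupOfForm σ J)) : GL (Fin 3) K) : Matrix (Fin 3) (Fin 3) K) =
      !![(ϖ ^ m)⁻¹, -y * (ϖ ^ m)⁻¹, σ z * (ϖ ^ m)⁻¹; 0, 1, σ y; 0, 0, ϖ ^ m] := by
  rw [Subgroup.coe_inv, Matrix.coe_units_inv, hu]
  exact Matrix.inv_eq_left_inv (mul_flickerU_of_rel_eq_one σ hd.ϖ_ne_zero hz m)

include hJ in
/-- **`u(y, z) = u_0^{(y,z)} ∈ K₀`** when `|y| ≤ 1` and `|z| ≤ 1` (`K₀` is cut out by the entries, ★ `mem_unitaryInt_iff_forall_v_apply_le_one`).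
[cite: Flicker1998UnitaryFL, Prop. 4 p. 81] -/
theorem mem_unitaryInt_of_coe_eq_upper (hσv : ∀ x, Valued.v (σ x) = Valued.v x) {y z : K} (hyv : Valued.v y ≤ 1) (hzv : Valued.v z ≤ 1)
    {u : ↥(unitaryGroupOfForm σ J)} (hu : ((u : GL (Fin 3) K) : Matrix (Fin 3) (Fin 3) K) = !![1, y, z; 0, 1, -σ y; 0, 0, 1]) :
    u ∈ unitaryInt σ J := by
  rw [mem_unitaryInt_iff_forall_v_apply_le_one σ hJ hσv]
  intro i j
  rw [hu]
  have hσyv : Valued.v (σ y) ≤ 1 := by rw [hσv]; exact hyv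
  fin_cases i <;> fin_cases j <;> simp [hyv, hzv, hσyv]

/-- **The middle row of `u_m^{(y,z)}`** for `|y| = 1`: valuations `0, 1, q^m` — all `≤ exp m`, and `= exp m` at the entry `(1, 2) = −σy·ϖ^{−m}`.  (The invariant
behind the disjointness of the double cosets.) [cite: Flicker1998UnitaryFL, Prop. 4 p. 81] -/
theorem v_apply_one_of_coe_eq_flickerU_of_rel (hd : UnramifiedLocalConjDatum σ ϖ) {y z : K} (hy : Valued.v y = 1) {m : ℕ}
    {u : ↥(unitaryGroupOfForm σ J)}
    (hu : ((u : GL (Fin 3) K) : Matrix (Fin 3) (Fin 3) K) = !![ϖ ^ m, y, z * (ϖ ^ m)⁻¹; 0, 1, -σ y * (ϖ ^ m)⁻¹; 0, 0, (ϖ ^ m)⁻¹]) :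
    (∀ l, Valued.v (((u : GL (Fin 3) K) : Matrix (Fin 3) (Fin 3) K) 1 l) ≤ WithZero.exp (m : ℤ)) ∧
      Valued.v (((u : GL (Fin 3) K) : Matrix (Fin 3) (Fin 3) K) 1 2) = WithZero.exp (m : ℤ) := by
  have hvσy : Valued.v (σ y) = 1 := by rw [hd.vσ, hy]
  have h12 : Valued.v (((u : GL (Fin 3) K) : Matrix (Fin 3) (Fin 3) K) 1 2) = WithZero.exp (m : ℤ) := by
    rw [hu]; simp [map_mul, map_inv₀, map_pow, hvσy, hd.vϖ, ← WithZero.exp_nsmul]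
  refine ⟨fun l => ?_, h12⟩
  fin_cases l
  · simp [hu]
  · have h11 : ((u : GL (Fin 3) K) : Matrix (Fin 3) (Fin 3) K) 1 1 = 1 := by rw [hu]; rfl
    simp only [Fin.mk_one, h11, map_one, ← WithZero.exp_zero, WithZero.exp_le_exp]
    exact_mod_cast Nat.zero_le m
  · exact h12.le

/-! ## §2 The double cosets `H u_m^{(y,z)} K₀` are pairwise distinct -/

include hJ in
/-- **The double cosets `H u_m^{(y,z)} K₀` are pairwise distinct** (`|y| = 1`): the supremum of the middle-row valuations is an invariant of `H g K₀`
(`H = Z(diag(1,−1,1))` scales the middle row by a unit — ★ `v_mul_apply_one_eq_of_mem_centralizer`, which needs the CHARACTERISTIC condition `(2 : K) ≠ 0`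
for the block shape of `H`, not `|2| = 1` — and `K₀` preserves integrality), and on `u_m^{(y,z)}` it equals `q^m`.  Twin of ★
`eq_of_centralizer_mul_flickerU_mul_unitaryInt_eq` with `|y| = 1` a hypothesis instead of a consequence of `y·σy = −2`, `|2| = 1`.
[cite: Flicker1998UnitaryFL, Prop. 4 p. 81] -/
theorem eq_of_centralizer_mul_flickerU_mul_unitaryInt_eq_of_rel (hd : UnramifiedLocalConjDatum σ ϖ) (h2 : (2 : K) ≠ 0)
    {y z : K} (hy : Valued.v y = 1)
    {c : ↥(unitaryGroupOfForm σ J)} (hc : ((c : GL (Fin 3) K) : Matrix (Fin 3) (Fin 3) K) = !![1, 0, 0; 0, -1, 0; 0, 0, 1])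
    {m n : ℕ} {h u k h' u' k' : ↥(unitaryGroupOfForm σ J)}
    (hh : h ∈ Subgroup.centralizer ({c} : Set ↥(unitaryGroupOfForm σ J)))
    (hu : ((u : GL (Fin 3) K) : Matrix (Fin 3) (Fin 3) K) = !![ϖ ^ m, y, z * (ϖ ^ m)⁻¹; 0, 1, -σ y * (ϖ ^ m)⁻¹; 0, 0, (ϖ ^ m)⁻¹])
    (hk : k ∈ unitaryInt σ J)
    (hh' : h' ∈ Subgroup.centralizer ({c} : Set ↥(unitaryGroupOfForm σ J)))
    (hu' : ((u' : GL (Fin 3) K) : Matrix (Fin 3) (Fin 3) K) = !![ϖ ^ n, y, z * (ϖ ^ n)⁻¹; 0, 1, -σ y * (ϖ ^ n)⁻¹; 0, 0, (ϖ ^ n)⁻¹])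
    (hk' : k' ∈ unitaryInt σ J) (heq : h * u * k = h' * u' * k') : m = n := by
  -- `exp m = |(u_m)₁₂| ≤ sup of the middle row of g ≤ exp n`, and symmetrically
  have key : ∀ {p q : ℕ} {a v b a' v' b' : ↥(unitaryGroupOfForm σ J)},
      a ∈ Subgroup.centralizer ({c} : Set ↥(unitaryGroupOfForm σ J)) →
      ((v : GL (Fin 3) K) : Matrix (Fin 3) (Fin 3) K) = !![ϖ ^ p, y, z * (ϖ ^ p)⁻¹; 0, 1, -σ y * (ϖ ^ p)⁻¹; 0, 0, (ϖ ^ p)⁻¹] →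
      b ∈ unitaryInt σ J → a' ∈ Subgroup.centralizer ({c} : Set ↥(unitaryGroupOfForm σ J)) →
      ((v' : GL (Fin 3) K) : Matrix (Fin 3) (Fin 3) K) = !![ϖ ^ q, y, z * (ϖ ^ q)⁻¹; 0, 1, -σ y * (ϖ ^ q)⁻¹; 0, 0, (ϖ ^ q)⁻¹] →
      b' ∈ unitaryInt σ J → a * v * b = a' * v' * b' → p ≤ q := by
    intro p q a v b a' v' b' ha hv hb ha' hv' hb' he
    -- middle row of `g = a' v' b'` is bounded by `exp q`
    have hg : ∀ l, Valued.v ((((a' * v' * b' : ↥(unitaryGroupOfForm σ J)) : GL (Fin 3) K) : Matrix (Fin 3) (Fin 3) K) 1 l) ≤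
        WithZero.exp (q : ℤ) := fun l => by
      rw [mul_assoc, v_mul_apply_one_eq_of_mem_centralizer σ hJ hd.vσ h2 hc ha']
      exact v_mul_apply_one_le_of_mem_unitaryInt σ hJ hd.vσ v' hb' (v_apply_one_of_coe_eq_flickerU_of_rel σ hd hy hv').1 l
    -- `v = a⁻¹ g b⁻¹`
    have hv_eq : v = a⁻¹ * (a' * v' * b') * b⁻¹ := by rw [← he]; group
    have h1 : Valued.v (((v : GL (Fin 3) K) : Matrix (Fin 3) (Fin 3) K) 1 2) ≤ WithZero.exp (q : ℤ) := by
      rw [hv_eq]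
      refine v_mul_apply_one_le_of_mem_unitaryInt σ hJ hd.vσ _ ((unitaryInt σ J).inv_mem hb) (fun l => ?_) 2
      rw [v_mul_apply_one_eq_of_mem_centralizer σ hJ hd.vσ h2 hc ((Subgroup.centralizer _).inv_mem ha)]
      exact hg l
    rw [(v_apply_one_of_coe_eq_flickerU_of_rel σ hd hy hv).2, WithZero.exp_le_exp] at h1
    exact_mod_cast h1
  exact le_antisymm (key hh hu hk hh' hu' hk' heq) (key hh' hu' hk' hh hu hk heq.symm)

/-! ## §3 The decomposition `U = ⋃_{m ≥ 0} H · u_m^{(y,z)} · K₀` — no `½` -/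

set_option maxHeartbeats 400000 in
include hJ in
/-- **FLICKER'S DOUBLE-COSET DECOMPOSITION `G = ⋃_{m ≥ 0} H u_m^{(y,z)} K` at every residue characteristic** [Flicker1998UnitaryFL Prop. 4, pp. 80–81]:
`K` a valued field with an ★ `UnramifiedLocalConjDatum σ ϖ` (isometric involution `σ`, `σ`-fixed uniformiser `ϖ`; NO `|2| = 1`), `(y, z)` with `|y| = 1`,
`|z| ≤ 1`, `z + σz + y·σy = 0`, `U = U(σ, Φ₃)(K)`, `H = Z_U(c)`, `c = diag(1,−1,1)`, `K₀ = U ∩ GL₃(𝒪)`: EVERY `g ∈ U` is `h · u_m^{(y,z)} · k` with `m ≥ 0`,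
`h ∈ H`, `k ∈ K₀`.  Proof: Iwasawa `g = b k` (★ `HermitianLattice.exists_eq_upper_mul_unitaryInt`), `b = n τ`, `T ≤ H`; the unipotent `u(w, z₀)`
(`z₀ + σz₀ + wσw = 0`) splits as `u(0, z₀ − z₁) · u(w, z₁)` with **`z₁ := (wσw ∕ yσy)·z`** — `z₁ + σz₁ = −wσw` by the relation, so `z₀ − z₁` is skew and
`u(0, z₀ − z₁) ∈ H` (this replaces Flicker's `z₁ = −wσw∕2`); if `|w| ≤ 1` then `u(w, z₁) ∈ K₀` (`m = 0`), else `w∕y = ε ϖ^{−m}`, `|ε| = 1`, and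
`u(w, z₁) = d(w∕y, 1, ·) · u_m^{(y,z)} · d(ε⁻¹, 1, σε)` with `d(w∕y,1,·) ∈ T ≤ H`, `d(ε⁻¹,1,σε) ∈ K₀`.  Twin of ★
`exists_mem_centralizer_mul_flickerU_mul_mem_unitaryInt`. [cite: Flicker1998UnitaryFL, Prop. 4 pp. 80–81] [cite: Rogawski1990, §4.5 p. 45] -/
theorem exists_mem_centralizer_mul_flickerU_mul_mem_unitaryInt_of_rel (hd : UnramifiedLocalConjDatum σ ϖ)
    {y z : K} (hy : Valued.v y = 1) (hzv : Valued.v z ≤ 1) (hz : z + σ z + y * σ y = 0)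
    {c : ↥(unitaryGroupOfForm σ J)} (hc : ((c : GL (Fin 3) K) : Matrix (Fin 3) (Fin 3) K) = !![1, 0, 0; 0, -1, 0; 0, 0, 1])
    (g : ↥(unitaryGroupOfForm σ J)) :
    ∃ (m : ℕ) (h u k : ↥(unitaryGroupOfForm σ J)), h ∈ Subgroup.centralizer ({c} : Set ↥(unitaryGroupOfForm σ J)) ∧
      ((u : GL (Fin 3) K) : Matrix (Fin 3) (Fin 3) K) = !![ϖ ^ m, y, z * (ϖ ^ m)⁻¹; 0, 1, -σ y * (ϖ ^ m)⁻¹; 0, 0, (ϖ ^ m)⁻¹] ∧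
      k ∈ unitaryInt σ J ∧ g = h * u * k := by
  subst hJ
  -- scalar facts
  have hy0 : y ≠ 0 := fun h0 => by rw [h0, map_zero] at hy; exact zero_ne_one hy
  have hσy0 : σ y ≠ 0 := (map_ne_zero σ).2 hy0
  have hvσy : Valued.v (σ y) = 1 := by rw [hd.vσ, hy]
  have hN0 : y * σ y ≠ 0 := mul_ne_zero hy0 hσy0
  have hϖ0 : ϖ ≠ 0 := hd.ϖ_ne_zero
  have hσσ := hd.σσ
  have hσyy : σ (y * σ y) = y * σ y := by rw [map_mul, hσσ, mul_comm]
  -- Iwasawa `g = b k`, Levi `b = n τ`, and `g = τ (τ⁻¹ n τ) k`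
  obtain ⟨b, k, hk, hbtri, hgbk⟩ := HermitianLattice.exists_eq_upper_mul_unitaryInt hd.σσ hd.vσ g
  obtain ⟨u₁, hu₁, d, hdT, -, hbud⟩ := exists_unipotent_mul_torus_of_mem_borelOfForm (σ := σ) (N := 3)
    ((mem_borelU_iff_mem_borelOfForm rfl b).1 hbtri)
  have huU : u₁ ∈ unitaryGroupOfForm σ ((StdForm.antidiagonal 3).over K) := hu₁.1
  have hdU : glDiagonal 3 K d ∈ unitaryGroupOfForm σ ((StdForm.antidiagonal 3).over K) := hdT.1
  set n : ↥(unitaryGroupOfForm σ ((StdForm.antidiagonal 3).over K)) := ⟨u₁, huU⟩ with hndef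
  set τ : ↥(unitaryGroupOfForm σ ((StdForm.antidiagonal 3).over K)) := ⟨glDiagonal 3 K d, hdU⟩ with hτdef
  have hn : n ∈ unipotentU σ ((StdForm.antidiagonal 3).over K) := hu₁.2
  have hτ : τ ∈ torusU σ ((StdForm.antidiagonal 3).over K) := ⟨d, rfl⟩
  have hbnt : b = n * τ := Subtype.ext hbud
  have hτH := mem_centralizer_of_mem_torusU σ rfl hc hτ
  have hn' : τ⁻¹ * n * τ ∈ unipotentU σ ((StdForm.antidiagonal 3).over K) := inv_mul_mul_mem_unipotentU σ rfl hτ hn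
  obtain ⟨w, z₀, hn'M, hrel⟩ := exists_coe_eq_upper_of_mem_unipotentU σ rfl hσσ hn'
  have hg' : g = τ * (τ⁻¹ * n * τ) * k := by rw [hgbk, hbnt]; group
  -- the split `u(w, z₀) = u(0, z₀ − z₁) · u(w, z₁)`, `z₁ := (wσw ∕ yσy)·z`
  set z₁ : K := w * σ w / (y * σ y) * z with hz₁def
  have hσz₁ : σ z₁ = w * σ w / (y * σ y) * σ z := by
    rw [hz₁def, map_mul, map_div₀, map_mul, hσσ, hσyy, mul_comm (σ w) w]
  have hz₁rel : z₁ + σ z₁ + w * σ w = 0 := by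
    rw [hσz₁, hz₁def]
    have e : w * σ w / (y * σ y) * z + w * σ w / (y * σ y) * σ z = w * σ w / (y * σ y) * (z + σ z) := by ring
    rw [e, show z + σ z = -(y * σ y) by linear_combination hz]
    field_simp
    ring
  have hσz : σ z₀ = -z₀ - w * σ w := by linear_combination hrel
  have hσskew : σ (z₀ - z₁) = -(z₀ - z₁) := by
    rw [map_sub, hσz]; linear_combination -hz₁rel
  obtain ⟨n₁, hn₁⟩ := exists_coe_eq_of_sum_t σ rfl !![1, 0, z₀ - z₁; 0, 1, 0; 0, 0, 1]
    (by rw [Matrix.det_fin_three]; simp) (by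
      intro a b
      fin_cases a <;> fin_cases b <;> simp [Fin.sum_univ_three, rev1t, rev2t, hσskew])
  obtain ⟨n₂, hn₂⟩ := exists_coe_eq_of_sum_t σ rfl !![1, w, z₁; 0, 1, -σ w; 0, 0, 1]
    (by rw [Matrix.det_fin_three]; simp) (by
      intro a b
      fin_cases a <;> fin_cases b <;> simp [Fin.sum_univ_three, rev1t, rev2t, map_neg, hσσ]
      · linear_combination hz₁rel)
  have hsplit : τ⁻¹ * n * τ = n₁ * n₂ := by
    apply Subtype.ext; apply Units.ext
    rw [hn'M, Subgroup.coe_mul, Units.val_mul, hn₁, hn₂]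
    ext i j
    fin_cases i <;> fin_cases j <;> simp [Matrix.mul_apply, Fin.sum_univ_three]
  have hn₁H := mem_centralizer_of_coe_eq_upper_zero σ hc hn₁
  by_cases hw : Valued.v w ≤ 1
  · -- `m = 0`: `u(w, z₁) ∈ K₀`
    obtain ⟨u₀, hu₀⟩ := exists_coe_eq_flickerU_of_rel σ rfl hd hz 0
    have hu₀' : ((u₀ : GL (Fin 3) K) : Matrix (Fin 3) (Fin 3) K) = !![1, y, z; 0, 1, -σ y; 0, 0, 1] := by
      rw [hu₀]; simp
    have hu₀K : u₀ ∈ unitaryInt σ ((StdForm.antidiagonal 3).over K) := mem_unitaryInt_of_coe_eq_upper σ rfl hd.vσ hy.le hzv hu₀'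
    have hz₁v : Valued.v z₁ ≤ 1 := by
      rw [hz₁def, map_mul, map_div₀, map_mul, map_mul, hd.vσ, hy, hvσy, mul_one, div_one]
      exact mul_le_one' (mul_le_one' hw hw) hzv
    have hn₂K : n₂ ∈ unitaryInt σ ((StdForm.antidiagonal 3).over K) := mem_unitaryInt_of_coe_eq_upper σ rfl hd.vσ hw hz₁v hn₂
    refine ⟨0, τ * n₁, u₀, u₀⁻¹ * n₂ * k, Subgroup.mul_mem _ hτH hn₁H, hu₀,
      Subgroup.mul_mem _ (Subgroup.mul_mem _ ((unitaryInt σ _).inv_mem hu₀K) hn₂K) hk, ?_⟩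
    rw [hg', hsplit]; group
  · -- `|w| > 1`: `w ∕ y = ε ϖ^{-m}` with `m ≥ 1`, `|ε| = 1`
    have hw1 : 1 < Valued.v w := lt_of_not_ge hw
    have hw0 : w ≠ 0 := fun h0 => by rw [h0, map_zero] at hw1; exact not_lt_zero hw1
    obtain ⟨a0, ha0⟩ := WithZero.ne_zero_iff_exists.1 (ne_of_gt (lt_trans zero_lt_one hw1))
    set mz : ℤ := Multiplicative.toAdd a0 with hmzdef
    have hvw : Valued.v w = WithZero.exp mz := by rw [← ha0]; rfl
    have hmz : 0 < mz := by rw [hvw, ← WithZero.exp_zero, WithZero.exp_lt_exp] at hw1; exact hw1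
    obtain ⟨m, hm⟩ : ∃ m : ℕ, (m : ℤ) = mz := ⟨mz.toNat, Int.toNat_of_nonneg hmz.le⟩
    obtain ⟨α, hαdef⟩ : ∃ α : K, α = w / y := ⟨_, rfl⟩
    obtain ⟨ε, hεdef⟩ : ∃ ε : K, ε = α * ϖ ^ m := ⟨_, rfl⟩
    have hα0 : α ≠ 0 := by rw [hαdef]; exact div_ne_zero hw0 hy0
    have hσα0 : σ α ≠ 0 := (map_ne_zero σ).2 hα0
    have ht0 : ϖ ^ m ≠ 0 := pow_ne_zero _ hϖ0
    have hσt : σ (ϖ ^ m) = ϖ ^ m := by rw [map_pow, hd.σϖ]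
    have hε0 : ε ≠ 0 := by rw [hεdef]; exact mul_ne_zero hα0 ht0
    have hvε : Valued.v ε = 1 := by
      rw [hεdef, hαdef, map_mul, map_div₀, hy, div_one, map_pow, hvw, hd.vϖ, ← WithZero.exp_nsmul, ← WithZero.exp_add,
        ← WithZero.exp_zero]
      congr 1
      simp [← hm]
    -- `a = d(α, 1, (σα)⁻¹) ∈ T ≤ H`, `u_m^{(y,z)}`, `k_ε = d(ε⁻¹, 1, σ ε) ∈ K₀`
    obtain ⟨a, haT, ha⟩ := exists_coe_eq_diag σ rfl hσσ hα0 (β := 1) (by rw [map_one, one_mul])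
    obtain ⟨um, hum⟩ := exists_coe_eq_flickerU_of_rel σ rfl hd hz m
    obtain ⟨kε, -, hkε⟩ := exists_coe_eq_diag σ rfl hσσ (inv_ne_zero hε0) (β := 1) (by rw [map_one, one_mul])
    have hvσε : Valued.v (σ ε) = 1 := by rw [hd.vσ, hvε]
    have hkεK : kε ∈ unitaryInt σ ((StdForm.antidiagonal 3).over K) := by
      rw [mem_unitaryInt_iff_forall_v_apply_le_one σ rfl hd.vσ]
      intro i j
      rw [hkε]
      fin_cases i <;> fin_cases j <;> simp [map_inv₀, hvε, hvσε]
    -- scalar identities behind `u(w, z₁) = a · u_m · k_ε`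
    have hαy : α * y = w := by rw [hαdef]; field_simp
    have hσyσα : σ y * σ α = σ w := by rw [hαdef, map_div₀]; field_simp
    have hασα : α * σ α * z = z₁ := by
      rw [hz₁def, hαdef, map_div₀]
      field_simp
    have hσε : σ ε = σ α * ϖ ^ m := by rw [hεdef, map_mul, hσt]
    have hkε' : ((kε : GL (Fin 3) K) : Matrix (Fin 3) (Fin 3) K) = !![ε⁻¹, 0, 0; 0, 1, 0; 0, 0, σ α * ϖ ^ m] := by
      rw [hkε, map_inv₀, inv_inv, hσε]
    have hid : n₂ = a * um * kε := by
      apply Subtype.ext; apply Units.ext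
      rw [Subgroup.coe_mul, Subgroup.coe_mul, Units.val_mul, Units.val_mul, hn₂, ha, hum, hkε']
      simp only [Matrix.mul_fin_three]
      ext i j
      fin_cases i <;> fin_cases j <;> simp only [Matrix.of_apply, Matrix.cons_val', Matrix.cons_val_zero, Matrix.cons_val_one,
        Matrix.cons_val_fin_one, Matrix.cons_val, Matrix.empty_val', Fin.mk_one, Fin.zero_eta,
        Fin.reduceFinMk, mul_zero, zero_mul, add_zero, zero_add, mul_one, one_mul]
      · rw [hεdef]; field_simp
      · exact hαy.symm
      · rw [show α * (z * (ϖ ^ m)⁻¹) * (σ α * ϖ ^ m) = α * σ α * z by field_simp]; exact hασα.symm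
      · rw [show -σ y * (ϖ ^ m)⁻¹ * (σ α * ϖ ^ m) = -(σ y * σ α) by field_simp, hσyσα]
      · field_simp
    refine ⟨m, τ * n₁ * a, um, kε * k, Subgroup.mul_mem _ (Subgroup.mul_mem _ hτH hn₁H) (mem_centralizer_of_mem_torusU σ rfl hc haT),
      hum, Subgroup.mul_mem _ hkεK hk, ?_⟩
    rw [hg', hsplit, hid]; group

/-! ## §4 The trace-frame instance `(y, z) = (1, −b)`, `b + σb = 1` -/

/-- **The trace-frame pair from the datum**: an unramified local conjugation datum supplies an integral `b` with `b + σb = 1` (★ `UnramifiedLocalConjDatum.trace`,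
Serre V §2), and then `(y, z) := (1, −b)` satisfies `|y| = 1`, `|z| ≤ 1` and the unipotent relation `z + σz + y·σy = 0` — the hypotheses of §2–§3, at every
residue characteristic. [cite: Serre1979, Ch. V §2 Prop. 3] [cite: Flicker1998UnitaryFL, Prop. 4 p. 80] -/
theorem exists_rel_of_trace (hd : UnramifiedLocalConjDatum σ ϖ) :
    ∃ b : K, Valued.v b ≤ 1 ∧ b + σ b = 1 ∧ Valued.v (1 : K) = 1 ∧ Valued.v (-b) ≤ 1 ∧ (-b) + σ (-b) + 1 * σ 1 = 0 := by
  obtain ⟨b, hbv, hb⟩ := hd.trace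
  refine ⟨b, hbv, hb, map_one _, by rw [Valuation.map_neg]; exact hbv, ?_⟩
  rw [map_neg, map_one]; linear_combination -hb

include hJ in
/-- **The trace-frame level elements `u_m^{(1,−b)} = !![ϖ^m, 1, −b·ϖ^{−m}; 0, 1, −ϖ^{−m}; 0, 0, ϖ^{−m}] ∈ U`** for `b + σb = 1` (the `Q_b`-currency of ★
`Rogawski1990/FlickerTorusTraceFrame`): the third column is isotropic because `1 − (b + σb) = 0`. [cite: Flicker1998UnitaryFL, Prop. 4 p. 80] -/
theorem exists_coe_eq_flickerU_trace (hd : UnramifiedLocalConjDatum σ ϖ) {b : K} (hb : b + σ b = 1) (m : ℕ) :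
    ∃ u : ↥(unitaryGroupOfForm σ J), ((u : GL (Fin 3) K) : Matrix (Fin 3) (Fin 3) K) =
      !![ϖ ^ m, 1, -b * (ϖ ^ m)⁻¹; 0, 1, -(ϖ ^ m)⁻¹; 0, 0, (ϖ ^ m)⁻¹] := by
  have hz : (-b) + σ (-b) + 1 * σ 1 = 0 := by rw [map_neg, map_one]; linear_combination -hb
  obtain ⟨u, hu⟩ := exists_coe_eq_flickerU_of_rel σ hJ hd hz m
  refine ⟨u, ?_⟩
  rw [hu, map_one]
  ext i j
  fin_cases i <;> fin_cases j <;> simp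

end Setting

end UnitaryGroup

end Literature.NumberTheory.Automorphic
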